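/-
Copyright (c) 2026 the pub-hodgecm-mathlib formalisation cell (harness21).  Planner seat hodgecm-mathlib-LH4-plan (g2): line LH4 (closer row `stub_N6nsShalika` after ED. 39
§2‴), HOME-only CAND «RESIDUAL NARROWING» — the Shalika print row is needed at the ODD non-split places only; 2026-09-02.
-/
import Literature.NumberTheory.Rogawski1990.LocalTransferIdentityCoreResidualStatementsSplit   -- ★ p848000 (LH4-p01 (g0)): `n6nsS3id_of_statements` over the constants ★ p847938 `N6nsS3ramStatement` ∕ `N6nsDyadicStatement` ∕ `N6nsShalikaStatement`; brings ★ p847670 and its imports (★ p847637 `s3id_of_shalikaAntidiag`, `s3id_descent_of_formCongr`, frame ★ (H2))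
import HarnessLib

/-!
# [Rogawski1990 §8.1 Prop. 8.1.1] «SHALIKA AT `Φ₃`, ODD PLACES» — the honest residual of the Shalika print row: the three-way split of the identity core
# `stub_N6nsS3id` consumes the germ expansion ONLY at the non-split places `v ∤ 2`

Topic `NumberTheory/Rogawski1990`; namespace `Literature.NumberTheory.Rogawski1990`.  ONE definition (a statement constant, no instance, no notation, no `sorry`) and
THEOREMS; kernel lane `--supports stmt-HodgeConjecture-24833`.  Cell `pub/hodgecm-mathlib` (D-0151), crux H413; line LH4 (germ road «N6nsGerm», closer row
`stub_N6nsShalika : N6nsShalikaStatement` after ED. 39 §2‴).  OBSERVATION (planner LH4-plan (g2)): in ★ p847670 `n6nsS3id_of_tameRamAntidiag_of_dyadic_of_shalikaAntidiag`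
the hypothesis `hsh` (Shalika at `Φ₃` at EVERY non-split place) is applied only inside the branch `h2 : IsUnit (2 : 𝒪_w)` — at a dyadic place the «DYADIC» residual
[LS₂] carries the whole identity core.  Hence the print row may be NARROWED, count-neutrally and with no new mathematics, from «every non-split `v`» to «every
non-split `v ∤ 2`»:
* `N6nsShalikaOddStatement` — «SHALIKA AT `Φ₃`, ODD»: `Subsingleton (PlacesOver L v) → IsUnit (2 : 𝒪_w) → ShalikaGermExpansionNonsplit L Φ₃ v` (one `w ∣ v` named, as in
  the «S3-RAM» constant);
* `n6nsShalikaOddStatement_of_n6nsShalikaStatement` — the old row implies the new one (so ED. 39's row closes the narrowed row by `exact`; nothing is lost);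
* `n6nsS3id_of_statements_odd : N6nsS3ramStatement → N6nsDyadicStatement → N6nsShalikaOddStatement → ‹the stub_N6nsS3id text›` — the three-way split re-proved
  over the NARROWED hypothesis (same three ★ branches as p847670: hyperspecial ★ `s3id_of_shalikaAntidiag`; tame ramified = frame ★ (H2) + ★ `s3id_descent_of_formCongr`
  over «S3-RAM at `Φ₃`»; dyadic = «DYADIC»).
WHY IT MATTERS FOR THE PAY-DOWN: at the odd places the tree already holds the unipotent classification of `U(Φ₃)` (★ `sq_zero_unipotent_cases`, ★
`sq_zero_unipotent_cases_of_ramified_complexConj`, ★ `exists_conj_eq_of_regular_unipotent`) and the RANK ∕ DUAL-PIECES organs (★ `exists_levelPieces_det_classOrbitalIntegral_ne_zero`,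
★ its tame-ramified twins, ★ `OrbitalIntegralDualPieces`), so an in-house proof of the narrowed row needs only the RANGA-RAO organ (invariant measures on the four unipotent
orbits + convergence) and the HOWE-SPAN organ (coinvariants of `C_c^∞` on a finite orbit stratification) — see the LH4 skeleton cand `StubN6nsShalika.paydown.skeleton`.

HONEST LABEL: HC_CM is proved only modulo the 7 printed citations (2 remaining named inputs: hLiu418 = stmt-HodgeConjecture-24832, h413 = stmt-HodgeConjecture-24833) until
rung 0 closes.  This file NARROWS the text of one print row and discharges nothing printed: a consumer of `(h : N6nsShalikaOddStatement)` is CONDITIONAL on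
[Rogawski1990 Prop. 8.1.1] at the odd non-split places; books count-neutral (the germ ∕ closer editions carry the rows — desk's and director's digits).

## References
* [Rogawski1990] J. D. Rogawski, *Automorphic Representations of Unitary Groups in Three Variables*, Ann. of Math. Stud. 123 (1990): §4.9 Prop. 4.9.1 (a) p. 55; §8.1
  Props. 8.1.1–8.1.2 pp. 112–114; §14.4 p. 237.
* [LanglandsShelstad1990Descent] R. P. Langlands, D. Shelstad, *Descent for transfer factors*, The Grothendieck Festschrift II, Progr. Math. 87 (1990): §2.1 (2.1.2).
* [HarishChandra1999AdmissibleDistributions] Harish-Chandra (notes by DeBacker–Sally), *Admissible Invariant Distributions on Reductive p-adic Groups*, AMS ULS 16 (1999), Thm. 8.1 p. 48.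
-/

set_option autoImplicit false

noncomputable section

open NumberField IsDedekindDomain MeasureTheory Measure Topology Filter
open Literature.NumberTheory.Rogawski1990 Literature.NumberTheory.Automorphic Literature.NumberTheory.GaloisRepresentations
open Literature.NumberTheory.Automorphic.UnitaryGroup Literature.NumberTheory.Automorphic.IntegralReduction
open Literature.AlgebraicGeometry.ShimuraVarieties (unitaryGroup hermForm)
open scoped Matrix MatrixGroups Classical ValuativeRel

namespace Literature.NumberTheory.Rogawski1990

/-! ## §1 The narrowed constant -/

/-- **«SHALIKA AT `Φ₃`, ODD PLACES» — the Shalika germ expansion at the identity for the quasi-split `U(Φ₃)(L⁺_v)` at every NON-SPLIT place `v ∤ 2`** (★ def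
`ShalikaGermExpansionNonsplit L Φ₃ v` under `Subsingleton (PlacesOver L v)` and `IsUnit (2 : 𝒪_w)` for the place `w ∣ v`): germs `Γ_u` indexed by finitely many unipotent
classes, independent of `f`, with `Φ(c, f) = Σ_u Φ(u, f)·Γ_u(c)` for the regular classes `c` near `1`.  PRINT: Harish-Chandra ∕ Shalika ∕ Ranga Rao as [Rogawski1990
Prop. 8.1.1]; this is ALL the three-way split of the identity core consumes (`n6nsS3id_of_statements_odd`).
[cite: Rogawski1990, §8.1 Prop. 8.1.1 p. 112] [cite: HarishChandra1999AdmissibleDistributions, Thm. 8.1 p. 48] -/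
def N6nsShalikaOddStatement : Prop :=
    ∀ (L : Type) [Field L] [NumberField L] [IsCMField L] (v : HeightOneSpectrum (𝓞 ↥(maximalRealSubfield L))) (w : UnitaryGroup.PlacesOver L v),
      Subsingleton (UnitaryGroup.PlacesOver L v) → IsUnit (2 : 𝒪[w.1.adicCompletion L]) →
        ShalikaGermExpansionNonsplit L (Matrix.of fun i j : Fin 3 => if i.val + j.val + 1 = 3 then (1 : L) else 0) v

/-- Unfolding `N6nsShalikaOddStatement` (by `Iff.rfl`). [cite: Rogawski1990, §8.1 Prop. 8.1.1 p. 112] -/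
theorem n6nsShalikaOddStatement_iff :
    N6nsShalikaOddStatement ↔
    ∀ (L : Type) [Field L] [NumberField L] [IsCMField L] (v : HeightOneSpectrum (𝓞 ↥(maximalRealSubfield L))) (w : UnitaryGroup.PlacesOver L v),
      Subsingleton (UnitaryGroup.PlacesOver L v) → IsUnit (2 : 𝒪[w.1.adicCompletion L]) →
        ShalikaGermExpansionNonsplit L (Matrix.of fun i j : Fin 3 => if i.val + j.val + 1 = 3 then (1 : L) else 0) v :=
  Iff.rfl

/-- **The row of record implies the narrowed row** (drop the parity hypothesis). [cite: Rogawski1990, §8.1 Prop. 8.1.1 p. 112] -/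
theorem n6nsShalikaOddStatement_of_n6nsShalikaStatement (h : N6nsShalikaStatement) : N6nsShalikaOddStatement :=
  fun L _ _ _ v _ hsub _ => h L v hsub

/-! ## §2 The three-way split over the NARROWED Shalika hypothesis -/

set_option maxHeartbeats 800000 in
-- statement-heavy: three letter-sized Prop texts as hypotheses (as ★ p847670)
/-- **`stub_N6nsS3id` ⟸ «S3-RAM AT `Φ₃`» + «DYADIC» + «SHALIKA AT `Φ₃`, ODD»** — the three-way split of ★ p847670 with the Shalika hypothesis NARROWED to the odd non-split
places: at a non-split place `v` of `L⁺` (one `w ∣ v`) — `2 ∉ 𝒪_w^×` → «DYADIC» ([LS₂], permanent print); `2 ∈ 𝒪_w^×` and `v` unramified → ★ `s3id_of_shalikaAntidiag` over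
the germ expansion AT THIS ODD PLACE; `2 ∈ 𝒪_w^×` and `v` ramified → frame ★ (H2) `HermitianFrame.exists_formCongr_conjLocal_eq_smul_antidiag_three` + ★ `s3id_descent_of_formCongr`
over «S3-RAM at `Φ₃`», again fed the germ expansion AT THIS ODD PLACE.  The conclusion is the germ line's `stub_N6nsS3id` text verbatim (= ★ `n6nsS3id_of_statements`).
[cite: LanglandsShelstad1990Descent, §2.1 (2.1.2)] [cite: Rogawski1990, §8.1 Props. 8.1.1–8.1.2 pp. 112–114; §4.9 Prop. 4.9.1 p. 55; §14.4 p. 237] -/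
theorem n6nsS3id_of_statements_odd :
    N6nsS3ramStatement → N6nsDyadicStatement → N6nsShalikaOddStatement →
    ∀ (L : Type) [Field L] [NumberField L] [IsCMField L] (H' : Matrix (Fin 3) (Fin 3) L) (μ : HeckeCharacter L)
      [∀ v : HeightOneSpectrum (𝓞 ↥(maximalRealSubfield L)),
        MeasurableSpace ((UnitaryGroup.cmDatum L 2 (Matrix.of fun i j : Fin 2 => if i.val + j.val + 1 = 2 then (1 : L) else 0)).Local v ×
          (UnitaryGroup.cmDatum L 1 (Matrix.of fun i j : Fin 1 => if i.val + j.val + 1 = 1 then (1 : L) else 0)).Local v)]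
      [∀ v : HeightOneSpectrum (𝓞 ↥(maximalRealSubfield L)),
        BorelSpace ((UnitaryGroup.cmDatum L 2 (Matrix.of fun i j : Fin 2 => if i.val + j.val + 1 = 2 then (1 : L) else 0)).Local v ×
          (UnitaryGroup.cmDatum L 1 (Matrix.of fun i j : Fin 1 => if i.val + j.val + 1 = 1 then (1 : L) else 0)).Local v)]
      [∀ v : HeightOneSpectrum (𝓞 ↥(maximalRealSubfield L)), MeasurableSpace ((UnitaryGroup.cmDatum L 3 H').Local v)]
      [∀ v : HeightOneSpectrum (𝓞 ↥(maximalRealSubfield L)), BorelSpace ((UnitaryGroup.cmDatum L 3 H').Local v)]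
      (νH : ∀ v : HeightOneSpectrum (𝓞 ↥(maximalRealSubfield L)),
        Measure ((UnitaryGroup.cmDatum L 2 (Matrix.of fun i j : Fin 2 => if i.val + j.val + 1 = 2 then (1 : L) else 0)).Local v ×
          (UnitaryGroup.cmDatum L 1 (Matrix.of fun i j : Fin 1 => if i.val + j.val + 1 = 1 then (1 : L) else 0)).Local v))
      (νG : ∀ v : HeightOneSpectrum (𝓞 ↥(maximalRealSubfield L)), Measure ((UnitaryGroup.cmDatum L 3 H').Local v))
      [∀ v, (νH v).IsHaarMeasure] [∀ v, (νH v).IsMulRightInvariant] [∀ v, (νG v).IsHaarMeasure] [∀ v, (νG v).IsMulRightInvariant],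
      μ.IsUnitary →
      (∀ x : ideleGroup ↥(maximalRealSubfield L), μ (AdeleRing.ideleBaseChange (↥(maximalRealSubfield L)) L x) = quadraticHeckeCharCM L x) →
      (H'.map (cmConjRingHom L)).transpose = H' →
      (∀ x : Fin 3 → L, Literature.AlgebraicGeometry.ShimuraVarieties.hermForm (cmConjRingHom L) H' x x = 0 → x = 0) →
      ∀ (v : HeightOneSpectrum (𝓞 ↥(maximalRealSubfield L))), Subsingleton (UnitaryGroup.PlacesOver L v) →
      ∀ [_iH : ∀ a : ((UnitaryGroup.cmDatum L 2 (Matrix.of fun i j : Fin 2 => if i.val + j.val + 1 = 2 then (1 : L) else 0)).Local v × (UnitaryGroup.cmDatum L 1 (Matrix.of fun i j : Fin 1 => if i.val + j.val + 1 = 1 then (1 : L) else 0)).Local v),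
          MeasurableSpace (((UnitaryGroup.cmDatum L 2 (Matrix.of fun i j : Fin 2 => if i.val + j.val + 1 = 2 then (1 : L) else 0)).Local v × (UnitaryGroup.cmDatum L 1 (Matrix.of fun i j : Fin 1 => if i.val + j.val + 1 = 1 then (1 : L) else 0)).Local v) ⧸
            Subgroup.centralizer ({a} : Set ((UnitaryGroup.cmDatum L 2 (Matrix.of fun i j : Fin 2 => if i.val + j.val + 1 = 2 then (1 : L) else 0)).Local v × (UnitaryGroup.cmDatum L 1 (Matrix.of fun i j : Fin 1 => if i.val + j.val + 1 = 1 then (1 : L) else 0)).Local v)))]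
        [_bH : ∀ a : ((UnitaryGroup.cmDatum L 2 (Matrix.of fun i j : Fin 2 => if i.val + j.val + 1 = 2 then (1 : L) else 0)).Local v × (UnitaryGroup.cmDatum L 1 (Matrix.of fun i j : Fin 1 => if i.val + j.val + 1 = 1 then (1 : L) else 0)).Local v),
          BorelSpace (((UnitaryGroup.cmDatum L 2 (Matrix.of fun i j : Fin 2 => if i.val + j.val + 1 = 2 then (1 : L) else 0)).Local v × (UnitaryGroup.cmDatum L 1 (Matrix.of fun i j : Fin 1 => if i.val + j.val + 1 = 1 then (1 : L) else 0)).Local v) ⧸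
            Subgroup.centralizer ({a} : Set ((UnitaryGroup.cmDatum L 2 (Matrix.of fun i j : Fin 2 => if i.val + j.val + 1 = 2 then (1 : L) else 0)).Local v × (UnitaryGroup.cmDatum L 1 (Matrix.of fun i j : Fin 1 => if i.val + j.val + 1 = 1 then (1 : L) else 0)).Local v)))]
        [_iG : ∀ γ : ((UnitaryGroup.cmDatum L 3 H').Local v), MeasurableSpace (((UnitaryGroup.cmDatum L 3 H').Local v) ⧸ Subgroup.centralizer ({γ} : Set ((UnitaryGroup.cmDatum L 3 H').Local v)))]
        [_bG : ∀ γ : ((UnitaryGroup.cmDatum L 3 H').Local v), BorelSpace (((UnitaryGroup.cmDatum L 3 H').Local v) ⧸ Subgroup.centralizer ({γ} : Set ((UnitaryGroup.cmDatum L 3 H').Local v)))]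
        (mH : OrbitalMeasureFamily ((UnitaryGroup.cmDatum L 2 (Matrix.of fun i j : Fin 2 => if i.val + j.val + 1 = 2 then (1 : L) else 0)).Local v × (UnitaryGroup.cmDatum L 1 (Matrix.of fun i j : Fin 1 => if i.val + j.val + 1 = 1 then (1 : L) else 0)).Local v))
        (mG : OrbitalMeasureFamily ((UnitaryGroup.cmDatum L 3 H').Local v)),
      mH.IsCanonical (IsLocalGRegular L v) (νH v) → mG.IsCanonical (fun γ => IsRegularElt (γ.val : GL (Fin 3) (UnitaryGroup.LocalRing L v))) (νG v) →
      ∀ (φ : ((UnitaryGroup.cmDatum L 3 H').Local v) → ℂ), IsLocSmooth φ →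
        ∃ V ∈ 𝓝 (1 : ((UnitaryGroup.cmDatum L 2 (Matrix.of fun i j : Fin 2 => if i.val + j.val + 1 = 2 then (1 : L) else 0)).Local v × (UnitaryGroup.cmDatum L 1 (Matrix.of fun i j : Fin 1 => if i.val + j.val + 1 = 1 then (1 : L) else 0)).Local v)), ∃ φH : ((UnitaryGroup.cmDatum L 2 (Matrix.of fun i j : Fin 2 => if i.val + j.val + 1 = 2 then (1 : L) else 0)).Local v × (UnitaryGroup.cmDatum L 1 (Matrix.of fun i j : Fin 1 => if i.val + j.val + 1 = 1 then (1 : L) else 0)).Local v) → ℂ, IsLocSmooth φH ∧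
          ∀ γH ∈ V, IsLocalGRegular L v γH →
            stableOrbitalIntegralRel (IsLocalStablyConjH L v) mH φH γH =
              ∑ᶠ c : ConjClasses ((UnitaryGroup.cmDatum L 3 H').Local v), ((finExplicitCollection L H' μ (finExplicitDelta_conj_left_all L H' μ) (finExplicitDelta_conj_right_all L H' μ)) v).Δ γH (Quotient.out c) * classOrbitalIntegral mG φ c := by
  intro hram hdy hsh L _ _ _ H' μ _ _ _ _ νH νG _ _ _ _ hμu hμω hH' hanis v hsub _iH _bH _iG _bG mH mG hmH hmG φ hφ
  obtain ⟨w⟩ : Nonempty (UnitaryGroup.PlacesOver L v) := inferInstance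
  have hw : IsCMField.complexConj L • w.1 = w.1 := smul_placesOver_eq_of_subsingleton L v (IsCMField.complexConj L) hsub w
  have hdet : H'.det ≠ 0 := Godement.det_ne_zero_of_anisotropic L H' hanis
  by_cases h2 : IsUnit (2 : 𝒪[w.1.adicCompletion L])
  · -- the germ expansion is consumed HERE ONLY, at an odd place
    have hshv : ShalikaGermExpansionNonsplit L (Matrix.of fun i j : Fin 3 => if i.val + j.val + 1 = 3 then (1 : L) else 0) v := hsh L v w hsub h2
    by_cases hv : Algebra.IsUnramifiedIn (𝓞 L) v.asIdeal
    · -- hyperspecial type: every form, every `μ` (★ p847637)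
      exact s3id_of_shalikaAntidiag L H' μ hH' hdet w hw hv hμω h2 (νH v) (νG v) hmH hmG hshv φ hφ
    · -- tame ramified: the «S3-ram» contract at `Φ₃`, descended along the frame ★ (H2)
      have he : v.asIdeal.ramificationIdx' w.1.asIdeal ≠ 1 := ramificationIdx'_ne_one_of_not_isUnramifiedIn_of_subsingleton L hsub w hv
      obtain ⟨T, a, ha, haσ, h⟩ := HermitianFrame.exists_formCongr_conjLocal_eq_smul_antidiag_three L H' hH' hdet w hw
      refine s3id_descent_of_formCongr L H' μ hH' hdet w hw (νG v) mH hmG T ha haσ h ?_ φ hφ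
      intro _ _ _ _ νG₃ _ _ mG₃ hmG₃ φ₃ hφ₃
      exact hram L μ w hw he hμu hμω h2 (νH v) νG₃ hmH hmG₃ hshv φ₃ hφ₃
  · -- dyadic: the permanent print residual
    exact hdy L H' μ νH νG hμu hμω hH' hanis v hsub (fun w' => by rwa [Subsingleton.elim w' w]) mH mG hmH hmG φ hφ


end Literature.NumberTheory.Rogawski1990

end
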